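import Summits.AtomisticToContinuum.FouriersLaw.Theorems.BondHeatUncertaintyExtensiveSnapshotIrreversibilityWeightedOddDQMAux2

/-!
# Weighted odd differentiability in quadratic mean (stub S_H2 of line `hellinger-logmean`), III: the stub from (H1) and (H2)

Helper file 3 (`--supports stmt-AtomisticToContinuum-9121`, crux `BondHeatUncertainty.ExtensiveSnapshotIrreversibility`)
for stub `stub_weightedOddDQM` (S_H2): the registered stub statement follows from the two residual inputs of
helper file 2 —

* (H1) `WeightedOddTightness`: there is `0 < η₀ ≤ 1/T` such that for every positive measurable square-root
  density family `s_δ` of the NESS near `δ = 0`: `∫ (s_δ - s_δ∘Θ)² e^{η₀H} dx ≤ C δ²` eventually in `δ ≠ 0`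
  (integrand integrable);
* (H2) `OddDiffQuotLocalL2`: for the `L²` response density `h` and every such family `s_δ`, on every energy
  sublevel set `{H ≤ R}`: `δ⁻¹(s_δ - s_δ∘Θ) → ½(h - h∘Θ)√ρ_T` in `L²({H ≤ R}, dx)` along `δ → 0`, `δ ≠ 0`
  (squared difference integrable eventually) —

in two packagings: `weightedOddDQM_of_tight_of_local'` / the registered `helper_weightedOddDQMReduction` take
(H1), (H2) for the given parameter point, family, `T`, `N`, `h` (local form), and
`stub_weightedOddDQM_of_tight_of_local : (H1-glob) → (H2-glob) → S_H2` takes them quantified exactly like the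
stub (the form in which they can be registered as stubs of a reshaped skeleton).  Proof: `η₀` from (H1); clause
(i) for that `η₀` from `helper_weightedOddDQMWeight` (helper file 1: weight removability holds for EVERY
`η₀ > 0`); clause (ii) from `weightedOddDQM_of_tight_of_local` (helper file 2).  No definitions; nothing here
closes the item; (H1), (H2) are NOT proved here.
-/

noncomputable section

namespace Summit.AtomisticToContinuum.FouriersLaw.Theorems.ExtensiveSnapshotIrreversibility.HellingerLogMean

open MeasureTheory Filter Topology Set
open scoped ENNReal NNReal ContDiff
open Literature.MathematicalPhysics.KineticTheory.HeatConduction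

/-- **S_H2 at one parameter point from (H1) and (H2) (local form)** = the registered helper
`helper_weightedOddDQMReduction`: `η₀` from the hypotheses, clause (i) from `helper_weightedOddDQMWeight`,
clause (ii) from `weightedOddDQM_of_tight_of_local`. [folklore] -/
theorem weightedOddDQM_of_tight_of_local' : ∀ ω₂ lam β γ : ℝ, 0 < ω₂ → 0 < lam → 0 < β → 0 < γ → (∀ (N : ℕ) (T_L T_R : ℝ), 0 < T_L → 0 < T_R → ∀ μ ν : Measure (PhaseSpace N), (pinnedChain ω₂ lam β γ).IsSteadyState N T_L T_R μ → (pinnedChain ω₂ lam β γ).IsSteadyState N T_L T_R ν → μ = ν) → ∀ μ : (N : ℕ) → ℝ → ℝ → Measure (PhaseSpace N), (∀ (N : ℕ) (T_L T_R : ℝ), 0 < T_L → 0 < T_R → (pinnedChain ω₂ lam β γ).IsSteadyState N T_L T_R (μ N T_L T_R)) → ∀ T : ℝ, 0 < T → ∀ N : ℕ, 2 ≤ N → ∀ h : PhaseSpace N → ℝ, (MemLp h 2 (μ N T T) ∧ (∀ F : PhaseSpace N → ℝ, ContDiff ℝ ((⊤ : ℕ∞) : WithTop ℕ∞) F → HasCompactSupport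 F → Tendsto (fun δ : ℝ => ((∫ x, F x ∂(μ N (T + δ / 2) (T - δ / 2))) - ∫ x, F x ∂(μ N T T)) / δ) (𝓝[≠] (0 : ℝ)) (𝓝 (∫ x, F x * h x ∂(μ N T T)))) ∧ (∀ i : Fin N, Tendsto (fun δ : ℝ => ((∫ x, (pinnedChain ω₂ lam β γ).bondCurrent N i x ∂(μ N (T + δ / 2) (T - δ / 2))) - ∫ x, (pinnedChain ω₂ lam β γ).bondCurrent N i x ∂(μ N T T)) / δ) (𝓝[≠] (0 : ℝ)) (𝓝 (∫ x, (pinnedChain ω₂ lam β γ).bondCurrent N i x * h x ∂(μ N T T))))) → ∀ η₀ : ℝ, 0 < η₀ → η₀ ≤ 1 / T → (∀ s : ℝ → PhaseSpace N → ℝ, (∀ δ, Measurable (s δ)) → (∀ δ x, 0 < s δ x) → (∀ᶠ δ in 𝓝[≠] (0 : ℝ), μ N (T + δ / 2) (T - δ / 2) = volume.withDensity (fun x => ENNReal.ofReal (s δ x ^ 2))) → ∃ C : ℝ, ∀ᶠ δ in 𝓝[≠] (0 : ℝ), Integrable (fun x => (s δ x - s δ (x.1, -x.2)) ^ 2 *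 Real.exp (η₀ * (pinnedChain ω₂ lam β γ).hamiltonian N x)) ∧ ∫ x, (s δ x - s δ (x.1, -x.2)) ^ 2 * Real.exp (η₀ * (pinnedChain ω₂ lam β γ).hamiltonian N x) ≤ C * δ ^ 2) → (∀ s : ℝ → PhaseSpace N → ℝ, (∀ δ, Measurable (s δ)) → (∀ δ x, 0 < s δ x) → (∀ᶠ δ in 𝓝[≠] (0 : ℝ), μ N (T + δ / 2) (T - δ / 2) = volume.withDensity (fun x => ENNReal.ofReal (s δ x ^ 2))) → ∀ R : ℝ, (∀ᶠ δ in 𝓝[≠] (0 : ℝ), IntegrableOn (fun x => (δ⁻¹ * (s δ x - s δ (x.1, -x.2)) - (1 / 2 : ℝ) * (h x - h (x.1, -x.2)) * Real.sqrt ((pinnedChain ω₂ lam β γ).gibbsDensity N T x / ∫ y, (pinnedChain ω₂ lam β γ).gibbsDensity N T y)) ^ 2) {x | (pinnedChain ω₂ lam β γ).hamiltonian N x ≤ R}) ∧ Tendsto (fun δ : ℝ => ∫ x in {x | (pinnedChain ω₂ lam β γ).hamiltonian N x ≤ R}, (δ⁻¹ * (s δ x - s δ (x.1, -x.2)) - (1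 / 2 : ℝ) * (h x - h (x.1, -x.2)) * Real.sqrt ((pinnedChain ω₂ lam β γ).gibbsDensity N T x / ∫ y, (pinnedChain ω₂ lam β γ).gibbsDensity N T y)) ^ 2) (𝓝[≠] (0 : ℝ)) (𝓝 0)) → ∃ η₀ : ℝ, 0 < η₀ ∧ (∀ K' : ℝ, ∫ x, (h x - h (x.1, -x.2)) ^ 2 ∂(μ N T T) < K' → ∃ η : ℝ, 0 < η ∧ η < η₀ ∧ ∫ x, (h x - h (x.1, -x.2)) ^ 2 * Real.cosh (η * (1 + (pinnedChain ω₂ lam β γ).hamiltonian N x)) ∂(μ N T T) < K') ∧ ∀ η : ℝ, 0 < η → η < η₀ → ∀ s : ℝ → PhaseSpace N → ℝ, (∀ δ, Measurable (s δ)) → (∀ δ x, 0 < s δ x) → (∀ᶠ δ in 𝓝[≠] (0 : ℝ), μ N (T + δ / 2) (T - δ / 2) = (volume : Measure (PhaseSpace N)).withDensity (fun x => ENNReal.ofReal (s δ x ^ 2))) → (∀ᶠ δ in 𝓝[≠] (0 : ℝ), Integrable (fun x : PhaseSpace N => (s δ x - s δ (x.1, -x.2)) ^ 2 * Real.cosh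 (η * (1 + (pinnedChain ω₂ lam β γ).hamiltonian N x))) (volume : Measure (PhaseSpace N))) ∧ Tendsto (fun δ : ℝ => (δ ^ 2)⁻¹ * ∫ x, (s δ x - s δ (x.1, -x.2)) ^ 2 * Real.cosh (η * (1 + (pinnedChain ω₂ lam β γ).hamiltonian N x)) ∂(volume : Measure (PhaseSpace N))) (𝓝[≠] (0 : ℝ)) (𝓝 ((1 / 4 : ℝ) * ∫ x, (h x - h (x.1, -x.2)) ^ 2 * Real.cosh (η * (1 + (pinnedChain ω₂ lam β γ).hamiltonian N x)) ∂(μ N T T))) := by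
  intro ω₂ lam β γ hω hl hβ hγ hU μ hμ T hT N hN h hh η₀ hη₀ hη₀T H1 H2
  refine ⟨η₀, hη₀, (helper_weightedOddDQMWeight ω₂ lam β γ hω hl hβ hγ hU μ hμ T hT N hN h hh).2 η₀ hη₀,
    fun η hη hηη₀ s hs hpos hdens => ?_⟩
  exact weightedOddDQM_of_tight_of_local hω hl hβ hγ hU hμ hT hN hh hη₀T hs (H1 s hs hpos hdens)
    (H2 s hs hpos hdens) hη hηη₀

/-- **S_H2 from (H1) weighted tightness and (H2) local quadratic-mean convergence, both quantified like the
stub** (so that they can be registered verbatim as stubs `stub_weightedOddTightness` / `stub_oddDiffQuotLocalL2`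
of a reshaped skeleton, whose S_H2 slot this theorem then fills). [folklore] -/
theorem stub_weightedOddDQM_of_tight_of_local
    (H1 : ∀ ω₂ lam β γ : ℝ, 0 < ω₂ → 0 < lam → 0 < β → 0 < γ → (∀ (N : ℕ) (T_L T_R : ℝ), 0 < T_L → 0 < T_R → ∀ μ ν : Measure (PhaseSpace N), (pinnedChain ω₂ lam β γ).IsSteadyState N T_L T_R μ → (pinnedChain ω₂ lam β γ).IsSteadyState N T_L T_R ν → μ = ν) → ∀ μ : (N : ℕ) → ℝ → ℝ → Measure (PhaseSpace N), (∀ (N : ℕ) (T_L T_R : ℝ), 0 < T_L → 0 < T_R → (pinnedChain ω₂ lam β γ).IsSteadyState N T_L T_R (μ N T_L T_R)) → ∀ T : ℝ, 0 < T → ∀ N : ℕ, 2 ≤ N → ∃ η₀ : ℝ, 0 < η₀ ∧ η₀ ≤ 1 / T ∧ ∀ s : ℝ → PhaseSpace N → ℝ, (∀ δ, Measurable (s δ)) → (∀ δ x, 0 < s δ x) → (∀ᶠ δ in 𝓝[≠] (0 : ℝ), μ N (T + δ / 2) (T - δ / 2) = (volume : Measure (PhaseSpace N)).withDensity (fun x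 => ENNReal.ofReal (s δ x ^ 2))) → ∃ C : ℝ, ∀ᶠ δ in 𝓝[≠] (0 : ℝ), Integrable (fun x : PhaseSpace N => (s δ x - s δ (x.1, -x.2)) ^ 2 * Real.exp (η₀ * (pinnedChain ω₂ lam β γ).hamiltonian N x)) (volume : Measure (PhaseSpace N)) ∧ ∫ x, (s δ x - s δ (x.1, -x.2)) ^ 2 * Real.exp (η₀ * (pinnedChain ω₂ lam β γ).hamiltonian N x) ∂(volume : Measure (PhaseSpace N)) ≤ C * δ ^ 2)
    (H2 : ∀ ω₂ lam β γ : ℝ, 0 < ω₂ → 0 < lam → 0 < β → 0 < γ → (∀ (N : ℕ) (T_L T_R : ℝ), 0 < T_L → 0 < T_R → ∀ μ ν : Measure (PhaseSpace N), (pinnedChain ω₂ lam β γ).IsSteadyState N T_L T_R μ → (pinnedChain ω₂ lam β γ).IsSteadyState N T_L T_R ν → μ = ν) → ∀ μ : (N : ℕ) → ℝ → ℝ → Measure (PhaseSpace N), (∀ (N : ℕ) (T_L T_R : ℝ), 0 < T_L → 0 < T_R → (pinnedChain ω₂ lam β γ).IsSteadyState N T_L T_R (μ N T_L T_R)) → ∀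 T : ℝ, 0 < T → ∀ N : ℕ, 2 ≤ N → ∀ h : PhaseSpace N → ℝ, (MemLp h 2 (μ N T T) ∧ (∀ F : PhaseSpace N → ℝ, ContDiff ℝ ((⊤ : ℕ∞) : WithTop ℕ∞) F → HasCompactSupport F → Tendsto (fun δ : ℝ => ((∫ x, F x ∂(μ N (T + δ / 2) (T - δ / 2))) - ∫ x, F x ∂(μ N T T)) / δ) (𝓝[≠] (0 : ℝ)) (𝓝 (∫ x, F x * h x ∂(μ N T T)))) ∧ (∀ i : Fin N, Tendsto (fun δ : ℝ => ((∫ x, (pinnedChain ω₂ lam β γ).bondCurrent N i x ∂(μ N (T + δ / 2) (T - δ / 2))) - ∫ x, (pinnedChain ω₂ lam β γ).bondCurrent N i x ∂(μ N T T)) / δ) (𝓝[≠] (0 : ℝ)) (𝓝 (∫ x, (pinnedChain ω₂ lam β γ).bondCurrent N i x * h x ∂(μ N T T))))) → ∀ s : ℝ → PhaseSpace N → ℝ, (∀ δ, Measurable (s δ)) → (∀ δ x, 0 < s δ x) → (∀ᶠ δ in 𝓝[≠] (0 : ℝ), μ N (T + δ / 2) (T - δ / 2) = (volume : Measure (PhaseSpace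 N)).withDensity (fun x => ENNReal.ofReal (s δ x ^ 2))) → ∀ R : ℝ, (∀ᶠ δ in 𝓝[≠] (0 : ℝ), IntegrableOn (fun x : PhaseSpace N => (δ⁻¹ * (s δ x - s δ (x.1, -x.2)) - (1 / 2 : ℝ) * (h x - h (x.1, -x.2)) * Real.sqrt ((pinnedChain ω₂ lam β γ).gibbsDensity N T x / ∫ y, (pinnedChain ω₂ lam β γ).gibbsDensity N T y)) ^ 2) {x | (pinnedChain ω₂ lam β γ).hamiltonian N x ≤ R} (volume : Measure (PhaseSpace N))) ∧ Tendsto (fun δ : ℝ => ∫ x in {x | (pinnedChain ω₂ lam β γ).hamiltonian N x ≤ R}, (δ⁻¹ * (s δ x - s δ (x.1, -x.2)) - (1 / 2 : ℝ) * (h x - h (x.1, -x.2)) * Real.sqrt ((pinnedChain ω₂ lam β γ).gibbsDensity N T x / ∫ y, (pinnedChain ω₂ lam β γ).gibbsDensity N T y)) ^ 2 ∂(volume : Measure (PhaseSpace N))) (𝓝[≠] (0 : ℝ)) (𝓝 0)) :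
    ∀ ω₂ lam β γ : ℝ, 0 < ω₂ → 0 < lam → 0 < β → 0 < γ → (∀ (N : ℕ) (T_L T_R : ℝ), 0 < T_L → 0 < T_R → ∀ μ ν : Measure (PhaseSpace N), (pinnedChain ω₂ lam β γ).IsSteadyState N T_L T_R μ → (pinnedChain ω₂ lam β γ).IsSteadyState N T_L T_R ν → μ = ν) → ∀ μ : (N : ℕ) → ℝ → ℝ → Measure (PhaseSpace N), (∀ (N : ℕ) (T_L T_R : ℝ), 0 < T_L → 0 < T_R → (pinnedChain ω₂ lam β γ).IsSteadyState N T_L T_R (μ N T_L T_R)) → ∀ T : ℝ, 0 < T → ∀ N : ℕ, 2 ≤ N → ∀ h : PhaseSpace N → ℝ, (MemLp h 2 (μ N T T) ∧ (∀ F : PhaseSpace N → ℝ, ContDiff ℝ ((⊤ : ℕ∞) : WithTop ℕ∞) F → HasCompactSupport F → Tendsto (fun δ : ℝ => ((∫ x, F x ∂(μ N (T + δ / 2) (T - δ / 2))) - ∫ x, F x ∂(μ N T T)) / δ) (𝓝[≠] (0 : ℝ)) (𝓝 (∫ x, F x * h x ∂(μ N T T)))) ∧ (∀ i : Fin N, Tendsto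 (fun δ : ℝ => ((∫ x, (pinnedChain ω₂ lam β γ).bondCurrent N i x ∂(μ N (T + δ / 2) (T - δ / 2))) - ∫ x, (pinnedChain ω₂ lam β γ).bondCurrent N i x ∂(μ N T T)) / δ) (𝓝[≠] (0 : ℝ)) (𝓝 (∫ x, (pinnedChain ω₂ lam β γ).bondCurrent N i x * h x ∂(μ N T T))))) → ∃ η₀ : ℝ, 0 < η₀ ∧ (∀ K' : ℝ, ∫ x, (h x - h (x.1, -x.2)) ^ 2 ∂(μ N T T) < K' → ∃ η : ℝ, 0 < η ∧ η < η₀ ∧ ∫ x, (h x - h (x.1, -x.2)) ^ 2 * Real.cosh (η * (1 + (pinnedChain ω₂ lam β γ).hamiltonian N x)) ∂(μ N T T) < K') ∧ ∀ η : ℝ, 0 < η → η < η₀ → ∀ s : ℝ → PhaseSpace N → ℝ, (∀ δ, Measurable (s δ)) → (∀ δ x, 0 < s δ x) → (∀ᶠ δ in 𝓝[≠] (0 : ℝ), μ N (T + δ / 2) (T - δ / 2) = (volume : Measure (PhaseSpace N)).withDensity (fun x => ENNReal.ofReal (s δ x ^ 2))) → (∀ᶠ δ in 𝓝[≠] (0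 : ℝ), Integrable (fun x : PhaseSpace N => (s δ x - s δ (x.1, -x.2)) ^ 2 * Real.cosh (η * (1 + (pinnedChain ω₂ lam β γ).hamiltonian N x))) (volume : Measure (PhaseSpace N))) ∧ Tendsto (fun δ : ℝ => (δ ^ 2)⁻¹ * ∫ x, (s δ x - s δ (x.1, -x.2)) ^ 2 * Real.cosh (η * (1 + (pinnedChain ω₂ lam β γ).hamiltonian N x)) ∂(volume : Measure (PhaseSpace N))) (𝓝[≠] (0 : ℝ)) (𝓝 ((1 / 4 : ℝ) * ∫ x, (h x - h (x.1, -x.2)) ^ 2 * Real.cosh (η * (1 + (pinnedChain ω₂ lam β γ).hamiltonian N x)) ∂(μ N T T))) := by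
  intro ω₂ lam β γ hω hl hβ hγ hU μ hμ T hT N hN h hh
  obtain ⟨η₀, hη₀, hη₀T, hC⟩ := H1 ω₂ lam β γ hω hl hβ hγ hU μ hμ T hT N hN
  exact weightedOddDQM_of_tight_of_local' ω₂ lam β γ hω hl hβ hγ hU μ hμ T hT N hN h hh η₀ hη₀ hη₀T hC
    (H2 ω₂ lam β γ hω hl hβ hγ hU μ hμ T hT N hN h hh)

/-! ## Registered helper stub -/

/-- **Registered helper stub of this file** (`helper_weightedOddDQMReduction`, crux
stmt-AtomisticToContinuum-9121, line `hellinger-logmean`): at one parameter point, (H1) weighted tightness →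
(H2) local quadratic-mean convergence of the odd difference quotient → the conclusion of the registered stub
`stub_weightedOddDQM` (S_H2) verbatim. [folklore] -/
theorem helper_weightedOddDQMReduction : ∀ ω₂ lam β γ : ℝ, 0 < ω₂ → 0 < lam → 0 < β → 0 < γ → (∀ (N : ℕ) (T_L T_R : ℝ), 0 < T_L → 0 < T_R → ∀ μ ν : Measure (PhaseSpace N), (pinnedChain ω₂ lam β γ).IsSteadyState N T_L T_R μ → (pinnedChain ω₂ lam β γ).IsSteadyState N T_L T_R ν → μ = ν) → ∀ μ : (N : ℕ) → ℝ → ℝ → Measure (PhaseSpace N), (∀ (N : ℕ) (T_L T_R : ℝ), 0 < T_L → 0 < T_R → (pinnedChain ω₂ lam β γ).IsSteadyState N T_L T_R (μ N T_L T_R)) → ∀ T : ℝ, 0 < T → ∀ N : ℕ, 2 ≤ N → ∀ h : PhaseSpace N → ℝ, (MemLp h 2 (μ N T T) ∧ (∀ F : PhaseSpace N → ℝ, ContDiff ℝ ((⊤ : ℕ∞) : WithTop ℕ∞) F → HasCompactSupport F → Tendsto (fun δ : ℝ => ((∫ x, F x ∂(μ N (T + δ / 2) (T - δ / 2))) - ∫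 x, F x ∂(μ N T T)) / δ) (𝓝[≠] (0 : ℝ)) (𝓝 (∫ x, F x * h x ∂(μ N T T)))) ∧ (∀ i : Fin N, Tendsto (fun δ : ℝ => ((∫ x, (pinnedChain ω₂ lam β γ).bondCurrent N i x ∂(μ N (T + δ / 2) (T - δ / 2))) - ∫ x, (pinnedChain ω₂ lam β γ).bondCurrent N i x ∂(μ N T T)) / δ) (𝓝[≠] (0 : ℝ)) (𝓝 (∫ x, (pinnedChain ω₂ lam β γ).bondCurrent N i x * h x ∂(μ N T T))))) → ∀ η₀ : ℝ, 0 < η₀ → η₀ ≤ 1 / T → (∀ s : ℝ → PhaseSpace N → ℝ, (∀ δ, Measurable (s δ)) → (∀ δ x, 0 < s δ x) → (∀ᶠ δ in 𝓝[≠] (0 : ℝ), μ N (T + δ / 2) (T - δ / 2) = volume.withDensity (fun x => ENNReal.ofReal (s δ x ^ 2))) → ∃ C : ℝ, ∀ᶠ δ in 𝓝[≠] (0 : ℝ), Integrable (fun x => (s δ x - s δ (x.1, -x.2)) ^ 2 * Real.exp (η₀ * (pinnedChain ω₂ lam β γ).hamiltonian N x)) ∧ ∫ x, (s δ x - s δ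 (x.1, -x.2)) ^ 2 * Real.exp (η₀ * (pinnedChain ω₂ lam β γ).hamiltonian N x) ≤ C * δ ^ 2) → (∀ s : ℝ → PhaseSpace N → ℝ, (∀ δ, Measurable (s δ)) → (∀ δ x, 0 < s δ x) → (∀ᶠ δ in 𝓝[≠] (0 : ℝ), μ N (T + δ / 2) (T - δ / 2) = volume.withDensity (fun x => ENNReal.ofReal (s δ x ^ 2))) → ∀ R : ℝ, (∀ᶠ δ in 𝓝[≠] (0 : ℝ), IntegrableOn (fun x => (δ⁻¹ * (s δ x - s δ (x.1, -x.2)) - (1 / 2 : ℝ) * (h x - h (x.1, -x.2)) * Real.sqrt ((pinnedChain ω₂ lam β γ).gibbsDensity N T x / ∫ y, (pinnedChain ω₂ lam β γ).gibbsDensity N T y)) ^ 2) {x | (pinnedChain ω₂ lam β γ).hamiltonian N x ≤ R}) ∧ Tendsto (fun δ : ℝ => ∫ x in {x | (pinnedChain ω₂ lam β γ).hamiltonian N x ≤ R}, (δ⁻¹ * (s δ x - s δ (x.1, -x.2)) - (1 / 2 : ℝ) * (h x - h (x.1, -x.2)) * Real.sqrt ((pinnedChain ω₂ lam β γ).gibbsDensity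 N T x / ∫ y, (pinnedChain ω₂ lam β γ).gibbsDensity N T y)) ^ 2) (𝓝[≠] (0 : ℝ)) (𝓝 0)) → ∃ η₀ : ℝ, 0 < η₀ ∧ (∀ K' : ℝ, ∫ x, (h x - h (x.1, -x.2)) ^ 2 ∂(μ N T T) < K' → ∃ η : ℝ, 0 < η ∧ η < η₀ ∧ ∫ x, (h x - h (x.1, -x.2)) ^ 2 * Real.cosh (η * (1 + (pinnedChain ω₂ lam β γ).hamiltonian N x)) ∂(μ N T T) < K') ∧ ∀ η : ℝ, 0 < η → η < η₀ → ∀ s : ℝ → PhaseSpace N → ℝ, (∀ δ, Measurable (s δ)) → (∀ δ x, 0 < s δ x) → (∀ᶠ δ in 𝓝[≠] (0 : ℝ), μ N (T + δ / 2) (T - δ / 2) = (volume : Measure (PhaseSpace N)).withDensity (fun x => ENNReal.ofReal (s δ x ^ 2))) → (∀ᶠ δ in 𝓝[≠] (0 : ℝ), Integrable (fun x : PhaseSpace N => (s δ x - s δ (x.1, -x.2)) ^ 2 * Real.cosh (η * (1 + (pinnedChain ω₂ lam β γ).hamiltonian N x))) (volume : Measure (PhaseSpace N))) ∧ Tendsto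 (fun δ : ℝ => (δ ^ 2)⁻¹ * ∫ x, (s δ x - s δ (x.1, -x.2)) ^ 2 * Real.cosh (η * (1 + (pinnedChain ω₂ lam β γ).hamiltonian N x)) ∂(volume : Measure (PhaseSpace N))) (𝓝[≠] (0 : ℝ)) (𝓝 ((1 / 4 : ℝ) * ∫ x, (h x - h (x.1, -x.2)) ^ 2 * Real.cosh (η * (1 + (pinnedChain ω₂ lam β γ).hamiltonian N x)) ∂(μ N T T))) :=
  weightedOddDQM_of_tight_of_local'

end Summit.AtomisticToContinuum.FouriersLaw.Theorems.ExtensiveSnapshotIrreversibility.HellingerLogMean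

end
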